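import Literature.NumberTheory.EllipticCurves.PAdicOneVariableSeriesFamilyOfCharacter
import Literature.NumberTheory.EllipticCurves.PAdicOneVariableNormCoherentUnitEquivarianceTwo
import Literature.NumberTheory.GaloisRepresentations.LubinTateComparisonDilationLTCoeff
import HarnessLib

/-!
# `p = 2`: the absolute norm-coherent units ARE an additive `[κ]`-equivariant series family — the hypotheses
# `hadd`/`hgal` of `PAdicOneVariableSeriesFamilyOfCharacter.lean` discharged for `φ b := ((δ(η b))~).map ι`

Topic `NumberTheory/EllipticCurves`; namespace `Literature.NumberTheory.EllipticCurves`.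

De Shalit, *Iwasawa theory of elliptic curves with complex multiplication* (1987), I.3.4 Lemma (i)/(ii) (p. 18) for
`β ∈ 𝒰`: `μ_{ββ'} = μ_β + μ_{β'}` rests on `δ(ββ') = δβ + δβ'`, and `μ_{σβ} ∘ κ(σ) = μ_β` on
`δ(σβ) = κ(σ)·((δβ) ∘ [κ(σ)]_{f'})`.  The β-agnostic files `PAdicOneVariableSeriesFamily{OfCharacter, MomentsOfCharacter,
GlueOfCharacter}` take exactly these two properties of a family of `𝐃`-series `φ : B → 𝒪̂_{F^nr}⟦X⟧` as hypotheses
`hadd`/`hgal`.  THIS file discharges them for the ABSOLUTE norm-coherent units of the Lubin–Tate tower of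
`f' = π'X + X²`, i.e. for `φ b := (((δ(η b))~).map ι)` with `η : B → 𝒰` multiplicative and `Γ_F`-equivariant:

* `map_tildeSer_logDeriv_mul` — `φ` of a product is the sum (`logDeriv_mul`, `tildeSer_add`);
* `map_tildeSer_logDeriv_galAct` — **`φ(β.galAct σ) = C(ι χ_{π'}(σ)) · (φ β ∘ homC' (χ_{π'}(σ)))`** (`tildeSer_logDeriv_galAct` +
  `map_eq_C_mul_subst_homC'_of_eq`);
* ★ `seriesFamily_hadd_of_normCoherentUnits`, ★ `seriesFamily_hgal_of_normCoherentUnits` — the two hypotheses VERBATIM,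
  from `hηmul : η (b b') = η b · η b'` and `hη : ∀ g ∈ U_0, ∃ σ ∈ Γ_F, η (g • b) = (η b).galAct σ ∧ e(χ_{π'}(σ)) = κ g`.

(The relative units over an unramified base are the other instance, pending their Coleman theory.)  Everything is
proved; no named facts, no definitions, no instances (section-local instance attributes as in the siblings), no `sorry`.

## References

* [deShalit1987] E. de Shalit, *Iwasawa theory of elliptic curves with complex multiplication* (1987),
  I.3.4 Lemma (i), (ii) (p. 18), I.2.3 (iv) (p. 14).
-/

noncomputable section

open MvPowerSeries

namespace Literature.NumberTheory.EllipticCurves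

section SeriesFamilyOfNormCoherentUnits

open ValuativeRel IsLocalRing Field
open Literature.NumberTheory.GaloisRepresentations Literature.NumberTheory.GaloisRepresentations.IsNonarchimedeanLocalField
  Literature.NumberTheory.GaloisRepresentations.LubinTate Literature.NumberTheory.PAdicHodge

variable {F : Type} [Field F] [ValuativeRel F] [TopologicalSpace F] [IsNonarchimedeanLocalField F]

attribute [local instance] ltNormUniformSpace ltNormIsUniformAddGroup rk1 nF nE fintypeResidueField

variable (h2 : (valuation F).IsUniformizer (((2 : ℕ) : 𝒪[F]) : F)) (u : 𝒪[F]ˣ)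

/-- **`ι((δ(ββ'))~) = ι((δβ)~) + ι((δβ')~)`** (`δ` and `(·)~` additive). [cite: deShalit1987, I.3.4 Lemma (i) (p. 18)] -/
theorem map_tildeSer_logDeriv_mul (β β' : NormCoherentUnits (isUniformizer_unit_mul h2 u)) :
    (tildeSer ((u : 𝒪[F]) * ((2 : ℕ) : 𝒪[F])) (LTCoeff.of F (u : 𝒪[F])) (β.mul β').logDeriv).map
        ((intToUnrCoeff F).comp (LTCoeff.of F).symm.toRingHom) =
      (tildeSer ((u : 𝒪[F]) * ((2 : ℕ) : 𝒪[F])) (LTCoeff.of F (u : 𝒪[F])) β.logDeriv).map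
          ((intToUnrCoeff F).comp (LTCoeff.of F).symm.toRingHom) +
        (tildeSer ((u : 𝒪[F]) * ((2 : ℕ) : 𝒪[F])) (LTCoeff.of F (u : 𝒪[F])) β'.logDeriv).map
          ((intToUnrCoeff F).comp (LTCoeff.of F).symm.toRingHom) := by
  rw [NormCoherentUnits.logDeriv_mul, tildeSer_add, map_add]

/-- **`ι((δ(σβ))~) = C(ι χ_{π'}(σ)) · (ι((δβ)~) ∘ homC' (χ_{π'}(σ)))`** — de Shalit's Lemma I.3.4 (ii) relation for the
log-free series, in the `𝐃`-currency of the series-family files. [cite: deShalit1987, I.3.4 Lemma (ii) (p. 18), I.2.3 (iv) (p. 14)] -/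
theorem map_tildeSer_logDeriv_galAct (σ : absoluteGaloisGroup F) (β : NormCoherentUnits (isUniformizer_unit_mul h2 u)) :
    (tildeSer ((u : 𝒪[F]) * ((2 : ℕ) : 𝒪[F])) (LTCoeff.of F (u : 𝒪[F])) (β.galAct σ).logDeriv).map
        ((intToUnrCoeff F).comp (LTCoeff.of F).symm.toRingHom) =
      PowerSeries.C (intToUnrCoeff F (lubinTateChar (isUniformizer_unit_mul h2 u) σ : 𝒪[F])) *
        PowerSeries.subst (homC' h2 u (lubinTateChar (isUniformizer_unit_mul h2 u) σ : 𝒪[F]))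
          ((tildeSer ((u : 𝒪[F]) * ((2 : ℕ) : 𝒪[F])) (LTCoeff.of F (u : 𝒪[F])) β.logDeriv).map
            ((intToUnrCoeff F).comp (LTCoeff.of F).symm.toRingHom)) :=
  map_eq_C_mul_subst_homC'_of_eq h2 u (lubinTateChar (isUniformizer_unit_mul h2 u) σ : 𝒪[F]) _ _
    (tildeSer_logDeriv_galAct (isUniformizer_unit_mul h2 u) (LTCoeff.of F (u : 𝒪[F])) σ β)

variable {G : Type*} [Group G] {𝒰 : SubgroupTower G} (κ : G →* ℤ_[2]ˣ) (e : 𝒪[F] →+* ℤ_[2])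
variable {B : Type*} [CommMonoid B] [MulDistribMulAction G B]
  (η : B → NormCoherentUnits (isUniformizer_unit_mul h2 u))
  (hηmul : ∀ b b' : B, η (b * b') = (η b).mul (η b'))
  (hη : ∀ g ∈ 𝒰.U 0, ∀ b : B, ∃ σ : absoluteGaloisGroup F, η (g • b) = (η b).galAct σ ∧
    Units.map (e : 𝒪[F] →* ℤ_[2]) (lubinTateChar (isUniformizer_unit_mul h2 u) σ) = κ g)

include hηmul in
/-- ★ **`hadd` of the series-family files for the absolute norm-coherent units**: the family
`b ↦ ι((δ(η b))~)` is additive. [cite: deShalit1987, I.3.4 Lemma (i) (p. 18)] -/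
theorem seriesFamily_hadd_of_normCoherentUnits (b b' : B) :
    (tildeSer ((u : 𝒪[F]) * ((2 : ℕ) : 𝒪[F])) (LTCoeff.of F (u : 𝒪[F])) (η (b * b')).logDeriv).map
        ((intToUnrCoeff F).comp (LTCoeff.of F).symm.toRingHom) =
      (tildeSer ((u : 𝒪[F]) * ((2 : ℕ) : 𝒪[F])) (LTCoeff.of F (u : 𝒪[F])) (η b).logDeriv).map
          ((intToUnrCoeff F).comp (LTCoeff.of F).symm.toRingHom) +
        (tildeSer ((u : 𝒪[F]) * ((2 : ℕ) : 𝒪[F])) (LTCoeff.of F (u : 𝒪[F])) (η b').logDeriv).map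
          ((intToUnrCoeff F).comp (LTCoeff.of F).symm.toRingHom) := by
  rw [hηmul]; exact map_tildeSer_logDeriv_mul h2 u (η b) (η b')

include hη in
/-- ★ **`hgal` of the series-family files for the absolute norm-coherent units**: for `g ∈ U_0` acting on `η b`
through `σ ∈ Γ_F` with `e(χ_{π'}(σ)) = κ g`, `ι((δ(η(g•b)))~) = C(ι a)·(ι((δ(η b))~) ∘ homC' a)` with `a = χ_{π'}(σ)`,
`κ g = e a`. [cite: deShalit1987, I.3.4 Lemma (ii) (p. 18)] -/
theorem seriesFamily_hgal_of_normCoherentUnits :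
    ∀ g ∈ 𝒰.U 0, ∀ b : B, ∃ a : 𝒪[F], (κ g : ℤ_[2]) = e a ∧
      (tildeSer ((u : 𝒪[F]) * ((2 : ℕ) : 𝒪[F])) (LTCoeff.of F (u : 𝒪[F])) (η (g • b)).logDeriv).map
          ((intToUnrCoeff F).comp (LTCoeff.of F).symm.toRingHom) =
        PowerSeries.C (intToUnrCoeff F a) * PowerSeries.subst (homC' h2 u a)
          ((tildeSer ((u : 𝒪[F]) * ((2 : ℕ) : 𝒪[F])) (LTCoeff.of F (u : 𝒪[F])) (η b).logDeriv).map
            ((intToUnrCoeff F).comp (LTCoeff.of F).symm.toRingHom)) := by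
  intro g hg b
  obtain ⟨σ, hσ, hκσ⟩ := hη g hg b
  refine ⟨(lubinTateChar (isUniformizer_unit_mul h2 u) σ : 𝒪[F]), ?_, ?_⟩
  · rw [← hκσ]; rfl
  · rw [hσ]; exact map_tildeSer_logDeriv_galAct h2 u σ (η b)

end SeriesFamilyOfNormCoherentUnits

end Literature.NumberTheory.EllipticCurves

end
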